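import Literature.AlgebraicGeometry.Resolution.RegularHomComposition
import Literature.AlgebraicGeometry.Resolution.RegularHomRegularLocus
import Literature.AlgebraicGeometry.Resolution.RegularHomLocalization
import Literature.AlgebraicGeometry.Resolution.JacobianRegularLocus
import Literature.AlgebraicGeometry.Resolution.PthRootDerivationRegular
import Mathlib.RingTheory.AdjoinRoot
import Mathlib.RingTheory.AdicCompletion.LocalRing
import HarnessLib

/-!
# Crux `Steer` (stmt-ResolutionOfSingularities-16345), chain W4.1, K-side R3c part 2: ISOLATEDNESS OF THE `p`-RADICAND
# GERM ASCENDS ALONG REGULAR LOCAL HOMOMORPHISMS, IN PARTICULAR TO THE COMPLETION (Theses-free, definition-free)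

OURS (campaign `res-hironaka`, rung L ★L-G4, slot W4.1; seat res-D-pv-004 AS res-L0-w41-stub-10; replaces the role of
no printed item and is NOT a statement of the manuscript under review [claim: Hironaka2017, status: under-review];
AI-produced, weaker than expert review). Second piece of R3c of `D/res-D-pv-004/K3-SCOPING.md`: the members `S m` of a
K(3) chain (`NoEternalIsolatedRadicandChainFinrank p 3 1`) are EXCELLENT regular local rings carrying
`HasIsolatedSingularity (RadicandRing (S m) p (f m))`; the K-side dictionary K3ᴵ reads each member in the Cohen model of
its completion `Ŝ m ≅ K_m⟦u⟧`, where the Jacobian criterion `JacobianCriterionFormal.isolated_iff_frame` (p511731)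
applies. This file moves the isolatedness hypothesis from `S m` to `Ŝ m`.

* `nonempty_baseChangeEquiv` — `S' ⊗_S S[T]/(g) ≅ S'[T]/(g)` as rings (Mathlib `AdjoinRoot.tensorAlgEquiv`,
  `S' ⊗_S S ≅ S'`).
* `isolated_baseChange` — for a REGULAR homomorphism `S → S'` of Noetherian local rings (flat, geometrically regular
  fibres — Matsumura §32) with `𝔪_S S' = 𝔪_{S'}`, `S` of characteristic `p`: if `S[T]/(T^p − f)` has an isolated
  singularity then so does `S'[T]/(T^p − f)`. Mechanism: regular homomorphisms survive the finite base change
  `S → B = S[T]/(T^p − f)` (`IsRegularHom.baseChange_of_quasiFinite`, Matsumura's proof of Thm. 32.1 (i)); regularity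
  ascends prime by prime along `B → S' ⊗_S B` (Thm. 23.7, `IsRegularHom.isRegularLocalRing_localization_iff`); and a
  non-maximal prime of `S' ⊗_S B ≅ S'[T]/(T^p − f)` lies over a non-maximal prime of `B`, since a prime over
  `𝔫_B ⊇ 𝔪_S` lies over `𝔪_S S' = 𝔪_{S'}` and `S' ⊗_S B` is integral over `S'`.
* `isolated_adicCompletion` (`S` a local G-ring; `IsGRing.isRegularHom_adicCompletion`,
  `AdicCompletion.maximalIdeal_eq_map`) and `isolated_adicCompletion_of_isExcellentRing`.

[cite: Matsumura1987, Thm. 23.7; Thm. 32.1 (i) (proof, p. 257); §32 p. 256] bears_on: LADDER-RESOLUTION L ★L-G4 W4.1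
(crux `Steer`, K(3) / R3c).
-/

noncomputable section

set_option linter.dupNamespace false

open IsLocalRing Polynomial TensorProduct

namespace Summit.ResolutionOfSingularities.ResolutionOfSingularities.Theorems.SwitchingDichotomy.RadicandAscent

open Literature.AlgebraicGeometry.Resolution

universe u

section BaseChange

variable {S S' : Type u} [CommRing S] [CommRing S'] [Algebra S S'] (g : S[X])

/-- **Adjoining a root commutes with base change, as a RING isomorphism `S' ⊗_S S[T]/(g) ≅ S'[T]/(g)`**
(Mathlib's `AdjoinRoot.tensorAlgEquiv` followed by `S' ⊗_S S ≅ S'`). [folklore] -/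
theorem nonempty_baseChangeEquiv :
    Nonempty (S' ⊗[S] AdjoinRoot g ≃+* AdjoinRoot (g.map (algebraMap S S'))) := by
  have hcomp : ((Algebra.TensorProduct.rid S S' S').toRingEquiv.toRingHom.comp
      (Algebra.TensorProduct.includeRight (R := S) (A := S') (B := S)).toRingHom) = algebraMap S S' := by
    ext x
    change Algebra.TensorProduct.rid S S' S' ((1 : S') ⊗ₜ[S] x) = algebraMap S S' x
    rw [Algebra.TensorProduct.rid_tmul, Algebra.algebraMap_eq_smul_one]
  have hassoc : Associated ((g.map (Algebra.TensorProduct.includeRight (R := S) (A := S') (B := S)).toRingHom).map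
      (Algebra.TensorProduct.rid S S' S').toRingEquiv.toRingHom) (g.map (algebraMap S S')) := by
    rw [Polynomial.map_map, hcomp]
  exact ⟨(AdjoinRoot.tensorAlgEquiv (R := S) (T := S') g _ rfl).toRingEquiv.trans
    (AdjoinRoot.mapRingEquiv (Algebra.TensorProduct.rid S S' S').toRingEquiv _ _ hassoc)⟩

end BaseChange

section Ascent

variable {S S' : Type u} [CommRing S] [CommRing S'] [Algebra S S'] [IsLocalRing S] [IsLocalRing S']
  [IsNoetherianRing S] [IsNoetherianRing S'] (p : ℕ) [Fact p.Prime] [CharP S p] (f : S)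

/-- Non-maximality of primes is reflected along a ring isomorphism (`Q ↦ Q.comap e`). [folklore] -/
theorem exists_lt_comap_of_exists_lt {A A' : Type u} [CommRing A] [CommRing A'] (e : A ≃+* A')
    {Q : Ideal A'} (hQ : ∃ Q' : Ideal A', Q'.IsPrime ∧ Q < Q') :
    ∃ P' : Ideal A, P'.IsPrime ∧ Q.comap (e : A →+* A') < P' := by
  obtain ⟨Q', hQ', hlt⟩ := hQ
  refine ⟨Q'.comap (e : A →+* A'), Ideal.comap_isPrime _ _, ?_⟩
  refine lt_of_le_of_ne (Ideal.comap_mono hlt.le) fun h => hlt.ne ?_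
  have := congrArg (Ideal.comap (e.symm : A' →+* A)) h
  simpa [Ideal.comap_comap, RingEquiv.symm_comp] using this

/-- **Isolatedness of the `p`-radicand germ ASCENDS along a regular local homomorphism with `𝔪S' = 𝔪'`.**
Let `S → S'` be a regular homomorphism (flat, geometrically regular fibres) of Noetherian local rings with
`𝔪_S S' = 𝔪_{S'}`, `S'` of characteristic `p`, and `f ∈ S`. If the torsor germ `B = S[T]/(T^p − f)` has an isolated
singularity (every non-maximal prime localises to a regular local ring), so does `S'[T]/(T^p − f)`. Proof: regular
homomorphisms are stable under the finite base change `S → B` (`IsRegularHom.baseChange_of_quasiFinite`), regularity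
ascends prime by prime along `B → S' ⊗_S B ≅ S'[T]/(T^p − f)` (Matsumura 23.7, `IsRegularHom.isRegularLocalRing_localization_iff`;
Mathlib `AdjoinRoot.tensorAlgEquiv`), and a non-maximal prime upstairs lies over a non-maximal prime of `B`, because
a prime of `S' ⊗_S B` over `𝔫_B ⊇ 𝔪_S` lies over `𝔪_S S' = 𝔪_{S'}` and `S' ⊗_S B` is integral over `S'`. OURS (plumbing
over classical inputs). [cite: Matsumura1987, Thm. 23.7 and Thm. 32.1 (i) (proof, p. 257)] -/
theorem isolated_baseChange (hreg : IsRegularHom S S')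
    (hmax : (maximalIdeal S).map (algebraMap S S') = maximalIdeal S')
    (hisol : ∀ (P : Ideal (AdjoinRoot ((X : S[X]) ^ p - C f))) [P.IsPrime],
      (∃ Q : Ideal (AdjoinRoot ((X : S[X]) ^ p - C f)), Q.IsPrime ∧ P < Q) →
        IsRegularLocalRing (Localization.AtPrime P))
    (Q' : Ideal (AdjoinRoot ((X : S'[X]) ^ p - C (algebraMap S S' f)))) [Q'.IsPrime]
    (hQ' : ∃ Q'' : Ideal (AdjoinRoot ((X : S'[X]) ^ p - C (algebraMap S S' f))), Q''.IsPrime ∧ Q' < Q'') :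
    IsRegularLocalRing (Localization.AtPrime Q') := by
  classical
  set g : S[X] := (X : S[X]) ^ p - C f with hg
  have hgmon : g.Monic := monic_X_pow_sub_C f (Fact.out : p.Prime).ne_zero
  have hg' : g.map (algebraMap S S') = (X : S'[X]) ^ p - C (algebraMap S S' f) := by
    rw [hg, Polynomial.map_sub, Polynomial.map_pow, Polynomial.map_X, Polynomial.map_C]
  -- `B = S[T]/(g)`, finite over `S`; `D = S' ⊗_S B ≅ C' = S'[T]/(g)`
  haveI : Module.Finite S (AdjoinRoot g) := hgmon.finite_adjoinRoot
  haveI : Module.Finite S' (S' ⊗[S] AdjoinRoot g) := inferInstance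
  haveI : Algebra.IsIntegral S' (S' ⊗[S] AdjoinRoot g) := inferInstance
  obtain ⟨e⟩ := nonempty_baseChangeEquiv (S' := S') g
  -- `B → D` is a regular homomorphism (base change of `S → S'` along the finite `S → B`)
  letI algBD : Algebra (AdjoinRoot g) (S' ⊗[S] AdjoinRoot g) := Algebra.TensorProduct.rightAlgebra
  have hregBD : IsRegularHom (AdjoinRoot g) (S' ⊗[S] AdjoinRoot g) := by
    have h1 : IsRegularHom (AdjoinRoot g) (AdjoinRoot g ⊗[S] S') := hreg.baseChange_of_quasiFinite (AdjoinRoot g)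
    refine IsRegularHom.of_algEquiv (AlgEquiv.ofRingEquiv
      (f := (Algebra.TensorProduct.comm S (AdjoinRoot g) S').toRingEquiv) fun b => ?_) h1
    change Algebra.TensorProduct.comm S (AdjoinRoot g) S' (b ⊗ₜ[S] (1 : S')) = (1 : S') ⊗ₜ[S] b
    exact Algebra.TensorProduct.comm_tmul S b (1 : S')
  -- the prime `Q` of `D` under `Q'` (through `e` and `hg'`), and `P = Q ∩ B`
  have hiso : Nonempty (S' ⊗[S] AdjoinRoot g ≃+* AdjoinRoot ((X : S'[X]) ^ p - C (algebraMap S S' f))) := by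
    rw [← hg']; exact ⟨e⟩
  obtain ⟨e'⟩ := hiso
  set Q : Ideal (S' ⊗[S] AdjoinRoot g) := Q'.comap (e' : _ →+* _) with hQ
  haveI hQprime : Q.IsPrime := Ideal.comap_isPrime _ _
  have hQlt : ∃ P' : Ideal (S' ⊗[S] AdjoinRoot g), P'.IsPrime ∧ Q < P' := exists_lt_comap_of_exists_lt e' hQ'
  haveI : IsNoetherianRing (S' ⊗[S] AdjoinRoot g) := IsNoetherianRing.of_finite S' _
  haveI : IsNoetherianRing (AdjoinRoot g) := IsNoetherianRing.of_finite S _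
  -- `P = Q ∩ B` is not maximal
  have hP : ∃ P' : Ideal (AdjoinRoot g), P'.IsPrime ∧ Q.under (AdjoinRoot g) < P' := by
    by_contra hcon
    push Not at hcon
    -- then `Q ∩ B` is maximal, hence `= 𝔫_B ⊇ 𝔪_S B`
    haveI : IsLocalRing (AdjoinRoot g) := isLocalRing_adjoinRoot_X_pow_sub_C_of_charP p f
    have hPmax : (Q.under (AdjoinRoot g)).IsMaximal := by
      obtain ⟨M, hM, hle⟩ := Ideal.exists_le_maximal (Q.under (AdjoinRoot g)) (Ideal.IsPrime.ne_top inferInstance)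
      rcases eq_or_lt_of_le hle with h | h
      · exact h ▸ hM
      · exact absurd h (hcon M hM.isPrime)
    have hPeq : Q.under (AdjoinRoot g) = maximalIdeal (AdjoinRoot g) := IsLocalRing.eq_maximalIdeal hPmax
    -- so `Q ∩ S' ⊇ 𝔪_S S' = 𝔪_{S'}`, and `Q` is maximal: contradiction
    have hle : maximalIdeal S' ≤ Q.under S' := by
      rw [← hmax, Ideal.map_le_iff_le_comap]
      intro s hs
      have hsB : algebraMap S (AdjoinRoot g) s ∈ Q.under (AdjoinRoot g) := by
        rw [hPeq]
        have hker : RingHom.ker (algebraMap S (AdjoinRoot g)) ≤ maximalIdeal S :=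
          IsLocalRing.le_maximalIdeal (RingHom.ker_ne_top _)
        obtain ⟨M, hM, hMS⟩ := Ideal.exists_ideal_over_maximal_of_isIntegral (maximalIdeal S) hker
        rw [← IsLocalRing.eq_maximalIdeal hM, ← Ideal.mem_comap, hMS]
        exact hs
      have h1 : algebraMap (AdjoinRoot g) (S' ⊗[S] AdjoinRoot g) (algebraMap S (AdjoinRoot g) s) ∈ Q := hsB
      change algebraMap S' (S' ⊗[S] AdjoinRoot g) (algebraMap S S' s) ∈ Q
      rw [← IsScalarTower.algebraMap_apply S S' (S' ⊗[S] AdjoinRoot g)]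
      have h2 : algebraMap (AdjoinRoot g) (S' ⊗[S] AdjoinRoot g) (algebraMap S (AdjoinRoot g) s) =
          algebraMap S (S' ⊗[S] AdjoinRoot g) s := by
        change Algebra.TensorProduct.includeRight (algebraMap S (AdjoinRoot g) s) = _
        exact (Algebra.TensorProduct.includeRight (R := S) (A := S') (B := AdjoinRoot g)).commutes s
      rwa [h2] at h1
    have hne : Q.under S' ≠ ⊤ := Ideal.comap_ne_top _ (Ideal.IsPrime.ne_top inferInstance)
    have hQSmax : (Q.under S').IsMaximal := by
      rw [← (IsLocalRing.maximalIdeal.isMaximal S').eq_of_le hne hle]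
      exact IsLocalRing.maximalIdeal.isMaximal S'
    have hQmax : Q.IsMaximal := Ideal.isMaximal_of_isIntegral_of_isMaximal_comap (R := S') Q hQSmax
    obtain ⟨P', hP', hlt⟩ := hQlt
    exact hlt.ne (hQmax.eq_of_le hP'.ne_top hlt.le)
  obtain ⟨P', hP', hPlt⟩ := hP
  have hregP : IsRegularLocalRing (Localization.AtPrime (Q.under (AdjoinRoot g))) :=
    hisol (Q.under (AdjoinRoot g)) ⟨P', hP', hPlt⟩
  have hregQ : IsRegularLocalRing (Localization.AtPrime Q) :=
    (hregBD.isRegularLocalRing_localization_iff Q).mpr hregP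
  -- transport along `e'`
  have hmem : (⟨Q, hQprime⟩ : PrimeSpectrum (S' ⊗[S] AdjoinRoot g)) ∈ regularLocus (S' ⊗[S] AdjoinRoot g) := by
    rw [mem_regularLocus]; exact hregQ
  have := (mem_regularLocus_iff_of_ringEquiv e' ⟨Q', inferInstance⟩).mpr hmem
  rw [mem_regularLocus] at this
  exact this

/-- **Isolatedness of the `p`-radicand germ ascends to the completion** of a Noetherian local G-ring `S` of
characteristic `p` (all formal fibres geometrically regular — e.g. `S` excellent): if `S[T]/(T^p − f)` has an isolated
singularity, so does `Ŝ[T]/(T^p − f)` over `Ŝ = (S, 𝔪)^`. (`S → Ŝ` is regular — Matsumura §32 p. 256, tree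
`IsGRing.isRegularHom_adicCompletion` — and `𝔪Ŝ` is the maximal ideal of `Ŝ`.) This is the per-stage input of the
K(3) dictionary: the chain members `S m` are excellent regular local rings, and the Jacobian criterion
(`JacobianCriterionFormal.isolated_iff_frame`, res-D-pv-004) is read in the Cohen model of `Ŝ m`.
[cite: Matsumura1987, §32 p. 256 and Thm. 23.7] -/
theorem isolated_adicCompletion (hS : IsGRing S)
    (hisol : ∀ (P : Ideal (AdjoinRoot ((X : S[X]) ^ p - C f))) [P.IsPrime],
      (∃ Q : Ideal (AdjoinRoot ((X : S[X]) ^ p - C f)), Q.IsPrime ∧ P < Q) →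
        IsRegularLocalRing (Localization.AtPrime P))
    (Q' : Ideal (AdjoinRoot ((X : (AdicCompletion (maximalIdeal S) S)[X]) ^ p -
      C (algebraMap S (AdicCompletion (maximalIdeal S) S) f)))) [Q'.IsPrime]
    (hQ' : ∃ Q'' : Ideal (AdjoinRoot ((X : (AdicCompletion (maximalIdeal S) S)[X]) ^ p -
      C (algebraMap S (AdicCompletion (maximalIdeal S) S) f))), Q''.IsPrime ∧ Q' < Q'') :
    IsRegularLocalRing (Localization.AtPrime Q') := by
  haveI : IsNoetherianRing (AdicCompletion (maximalIdeal S) S) := isNoetherianRing_adicCompletion_maximalIdeal S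
  exact isolated_baseChange p f hS.isRegularHom_adicCompletion AdicCompletion.maximalIdeal_eq_map.symm hisol Q' hQ'

/-- The same for an EXCELLENT Noetherian local ring `S` of characteristic `p` (excellent ⇒ quasi-excellent ⇒ G-ring).
[cite: Matsumura1987, §32 p. 260] -/
theorem isolated_adicCompletion_of_isExcellentRing (hS : IsExcellentRing S)
    (hisol : ∀ (P : Ideal (AdjoinRoot ((X : S[X]) ^ p - C f))) [P.IsPrime],
      (∃ Q : Ideal (AdjoinRoot ((X : S[X]) ^ p - C f)), Q.IsPrime ∧ P < Q) →
        IsRegularLocalRing (Localization.AtPrime P))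
    (Q' : Ideal (AdjoinRoot ((X : (AdicCompletion (maximalIdeal S) S)[X]) ^ p -
      C (algebraMap S (AdicCompletion (maximalIdeal S) S) f)))) [Q'.IsPrime]
    (hQ' : ∃ Q'' : Ideal (AdjoinRoot ((X : (AdicCompletion (maximalIdeal S) S)[X]) ^ p -
      C (algebraMap S (AdicCompletion (maximalIdeal S) S) f))), Q''.IsPrime ∧ Q' < Q'') :
    IsRegularLocalRing (Localization.AtPrime Q') :=
  isolated_adicCompletion p f hS.isQuasiExcellentRing.isGRing hisol Q' hQ'

end Ascent

end Summit.ResolutionOfSingularities.ResolutionOfSingularities.Theorems.SwitchingDichotomy.RadicandAscent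

end
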